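import Summits.QuantumFields.BalabanUV.Beta.ChartConjugationDefect

/-!
# `BalabanUV.Beta.ChartConjugationRelativeSX` — over a RELATIVE inverse the chart-conjugation defects are COMMUTATOR-VALUED
# (β sub-cell, row D1, the OWNER an2-g26's K4 «statement first» D-K4-1, file K4b of K4a ∕ K4b ∕ K4c; CLAIMS l.26301 (2); Lean by the
# K-U3d L2 author lineage t4-ne9-formalise-leaf-06 under the owner's FIRST REFUSAL R-5, «MINE K4b» CLAIMS l.26665)

HONEST FRAMING (cell contract, verbatim): «discharging `BetaPertH` makes Bałaban's UV stability UNCONDITIONAL — a real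
constructive-QFT result; it is NOT the continuum limit and NOT the Clay problem.»  THIS MODULE is elementary algebra of matrix-fibred
lattice kernels (absolutely convergent compositions and traces): it formalises NO statement printed in Bałaban's papers, cites none as a
hypothesis, mints no `def` and no `Prop` fact, instantiates NO binder of the wall and DISCHARGES NOTHING of it.  NOT summit progress;
NOT D1; NOT BetaPertH; NOT continuum; NOT Clay.

ABSOLUTE RULE (cell, verbatim): «No internally-minted statement may enter as a cited fact. Every hypothesis is either
kernel-proved in this package or a verbatim quotation of a PUBLISHED theorem with page reference. The manuscript(s) under
audit are NOT citable for their own disputed steps — they are the thing under adjudication; programme-internal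
(2001/route/tribunal) claims are never citable.»  Every theorem below is kernel-proved from explicit, abstract hypotheses.

PLACEMENT.  New cell work about the cell's OWN typed objects, under the registered cell topic `Summits/QuantumFields/BalabanUV/Beta/`;
imports K4a `ChartConjugationDefect` (owner's architecture decision, l.26301 (2)); imported by nothing under `Literature/`.

WHY (owner an2-g26, K4 ARCHITECTURE DECISION, CLAIMS l.26301 (2); an3-g48 THEOREM CX, `HOME/b2b-balaban-beta-an3/gen48/CX-COMMUTATOR.v1.md`).
an2's `ChartConjugationRelative` re-proves an5's chart-conjugation invariance from the four relative rules `RelInv A 𝕄 E` PLUS the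
commutations `E∘X = X∘E` of the contact generators with the slice projector `E`.  For the symmetrised slice letters the generators do NOT
commute with `E`: `C_X := conjV E X = E∘X − X∘E` has rank 2 at every interior jet bond (THEOREM CX).  K4a (`ChartConjugationDefect`) proved
the invariance identity WITH ITS DEFECT `Δ` for an ARBITRARY spread pair; THIS FILE (K4b) DROPS `hEX` from an2's file and shows that over
`RelInv A 𝕄 E` every defect is `C`-VALUED — each sandwiched rule, each trace rule, the sandwich defect `S_X` and the trace defect `τ(Y)`
acquire explicit commutator terms, all of which vanish when `C = 0` (recovering an2's `hess_conj_invariant_rel`, closing `example`).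
Exact-ℚ engines of this statement list: the owner's `work/sx_check.py` (17∕17; rational orthogonal projector `E`, `A := E(E𝕄E)⁻¹E`,
`A𝕄 ≠ E`) and an3's `gen48/toy/sx_defect.py` ((L1)–(L11), (D), (K): 10∕10) — evidence; the theorems below are the certificate.

CONTENT (the owner's signatures VERBATIM; `0 def`: `C_X := conjV E X`, `S_X := comp (comp A (conjV 𝕄 X)) A + conjV A X`,
`τ(Y) := tr (comp Y (conjV 𝕄 A))` DISPLAYED INLINE).  Hypotheses: `Spr A`, `Spr 𝕄`, `Spr E`, `RelInv A 𝕄 E`, localised letters; NO `hEX`.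
§1 THE RULES WITH COMMUTATOR TERMS: `comp_eq_comp_comp_E_SX : A∘X = (A∘X)∘E + A∘C_X`; `comp_eq_E_comp_comp_SX : X∘A = E∘(X∘A) − C_X∘A`;
**`rule_right_SX : (A∘X)∘(𝕄∘A) = A∘X − A∘C_X + (A∘C_X)∘(𝕄∘A)`**; **`rule_left_SX : (A∘𝕄)∘(X∘A) = X∘A + C_X∘A − (A∘𝕄)∘(C_X∘A)`**;
**`trace_KHY_SX : tr(A∘(𝕄∘Y)) = tr(E∘Y) − tr(C_Y∘(A∘𝕄))`**; **`trace_KYH_SX : tr(A∘(Y∘𝕄)) = tr(E∘Y) + tr(C_Y∘(𝕄∘A))`**.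
§2 THE DEFECTS ARE COMMUTATOR-VALUED: **`sandwichDefect_rel : S_X = C_X∘A + A∘C_X − (A∘𝕄)∘(C_X∘A) − (A∘C_X)∘(𝕄∘A)`**;
**`traceDefect_rel : τ(Y) = tr(C_Y∘(𝕄∘A)) + tr(C_Y∘(A∘𝕄))`**; `conjV_comp_leibniz : C_{X′∘X} = C_{X′}∘X + X′∘C_X` (no `RelInv` needed);
`hess_conj_defect_rel` = K4a's `hess_conj_defect` with the trace-defect pair `τ(X′∘X) − τ(X₂)` written in `C`-currency.
§3 `delta_rel_of_comm`: under `E∘X = X∘E`, `E∘X′ = X′∘E`, `E∘X₂ = X₂∘E` the defect `Δ` of K4a vanishes over `RelInv A 𝕄 E`, and an2's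
`ChartConjugationRelative.hess_conj_invariant_rel` is RECOVERED from K4a's `hess_conj_defect` (closing `example`, by `rw`).

RELATION TO THE TREE (no duplication): `RelInv` and its four projections are an2's; `conjV`∕`conjW` and their `Loc`-closure an5's; `spr_comp`
an2's; the defect identities K4a's; every analytic brick `TameKernelCalculus` — all USED BY NAME.  The `hEX`-SPECIAL CASES of §1 are an2's
`comp_eq_comp_comp_E` ∕ `comp_eq_E_comp_comp` ∕ `rule_right_rel` ∕ `rule_left_rel` ∕ `trace_KHY_rel` ∕ `trace_KYH_rel` and of §2 are
`RelInvSandwich.sandwich_conjV_rel` ∕ `SecondOrderSymContact.tadpole_conjV_rel_eq_zero` — NOT re-stated here (they follow by `C = 0`).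
NOT continuum, NOT Clay.
-/

open Finset
open scoped BigOperators
open Literature.MathematicalPhysics.QuantumFieldTheory.Balaban1983to89
open Literature.MathematicalPhysics.QuantumFieldTheory.Balaban1983to89.Beta
open ExpKernelCalculus (MKer Decays BiLoc comp tr bubble tadpole)
open HessKerSchurResolvent (idK comp_idK_left comp_idK_right)
open Summit.QuantumFields.BalabanUV.Beta.TameKernelCalculus
open Summit.QuantumFields.BalabanUV.Beta.ChartConjugation
open Summit.QuantumFields.BalabanUV.Beta.ChartConjugationRelative (RelInv spr_comp)
open Summit.QuantumFields.BalabanUV.Beta.ChartConjugationDefect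

namespace Summit.QuantumFields.BalabanUV.Beta.ChartConjugationRelativeSX

noncomputable section

variable {D : ℕ} {F : Type*} [Fintype F]

/-! ## §1 The sandwiched rules and the trace rules WITH COMMUTATOR TERMS (`C_X = conjV E X`; no `hEX`) -/

section Rules

variable {A M E : MKer D F}

/-- `A∘X = (A∘X)∘E + A∘C_X` with `C_X = conjV E X = E∘X − X∘E` (from `A∘E = A`; an2's `comp_eq_comp_comp_E` when `C_X = 0`). -/
theorem comp_eq_comp_comp_E_SX (hA : Spr A) (hE : Spr E) (hR : RelInv A M E) {X : MKer D F} (hX : Loc X) :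
    comp A X = comp (comp A X) E + comp A (conjV E X) := by
  have hsplit : comp E X = comp X E + conjV E X := by rw [conjV]; abel
  calc comp A X = comp (comp A E) X := by rw [hR.AE]
    _ = comp A (comp E X) := (comp_assoc_tame hA.tame hE.tame hX.tame).symm
    _ = comp A (comp X E + conjV E X) := by rw [hsplit]
    _ = comp A (comp X E) + comp A (conjV E X) := comp_add_right_tame hA.tame (hX.comp_spr hE).tame (loc_conjV hE hX).tame
    _ = comp (comp A X) E + comp A (conjV E X) := by rw [comp_assoc_tame hA.tame hX.tame hE.tame]

/-- `X∘A = E∘(X∘A) − C_X∘A` (from `E∘A = A`; an2's `comp_eq_E_comp_comp` when `C_X = 0`). -/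
theorem comp_eq_E_comp_comp_SX (hA : Spr A) (hE : Spr E) (hR : RelInv A M E) {X : MKer D F} (hX : Loc X) :
    comp X A = comp E (comp X A) - comp (conjV E X) A := by
  have hsplit : comp X E = comp E X - conjV E X := by rw [conjV]; abel
  calc comp X A = comp X (comp E A) := by rw [hR.EA]
    _ = comp (comp X E) A := comp_assoc_tame hX.tame hE.tame hA.tame
    _ = comp (comp E X - conjV E X) A := by rw [hsplit]
    _ = comp (comp E X) A - comp (conjV E X) A := comp_sub_left_tame (hE.comp_loc hX).tame (loc_conjV hE hX).tame hA.tame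
    _ = comp E (comp X A) - comp (conjV E X) A := by rw [comp_assoc_tame hE.tame hX.tame hA.tame]

/-- **SANDWICHED RIGHT RULE WITH COMMUTATOR**: `(A∘X)∘(𝕄∘A) = A∘X − A∘C_X + (A∘C_X)∘(𝕄∘A)` (an2's `rule_right_rel` when `C_X = 0`). -/
theorem rule_right_SX (hA : Spr A) (hM : Spr M) (hE : Spr E) (hR : RelInv A M E) {X : MKer D F} (hX : Loc X) :
    comp (comp A X) (comp M A) = comp A X - comp A (conjV E X) + comp (comp A (conjV E X)) (comp M A) := by
  have hAX : Loc (comp A X) := hA.comp_loc hX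
  have hAC : Loc (comp A (conjV E X)) := hA.comp_loc (loc_conjV hE hX)
  have hMA : Tame (comp M A) := (spr_comp hM hA).tame
  have h1 := comp_eq_comp_comp_E_SX hA hE hR hX
  calc comp (comp A X) (comp M A) = comp (comp (comp A X) E + comp A (conjV E X)) (comp M A) := by rw [← h1]
    _ = comp (comp (comp A X) E) (comp M A) + comp (comp A (conjV E X)) (comp M A) :=
        comp_add_left_tame (hAX.comp_spr hE).tame hAC.tame hMA
    _ = comp (comp A X) (comp E (comp M A)) + comp (comp A (conjV E X)) (comp M A) := by rw [comp_assoc_tame hAX.tame hE.tame hMA]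
    _ = comp (comp A X) (comp (comp E M) A) + comp (comp A (conjV E X)) (comp M A) := by rw [comp_assoc_tame hE.tame hM.tame hA.tame]
    _ = comp (comp A X) E + comp (comp A (conjV E X)) (comp M A) := by rw [hR.EMA]
    _ = comp A X - comp A (conjV E X) + comp (comp A (conjV E X)) (comp M A) := by rw [eq_sub_of_add_eq h1.symm]

/-- **SANDWICHED LEFT RULE WITH COMMUTATOR**: `(A∘𝕄)∘(X∘A) = X∘A + C_X∘A − (A∘𝕄)∘(C_X∘A)` (an2's `rule_left_rel` when `C_X = 0`). -/
theorem rule_left_SX (hA : Spr A) (hM : Spr M) (hE : Spr E) (hR : RelInv A M E) {X : MKer D F} (hX : Loc X) :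
    comp (comp A M) (comp X A) = comp X A + comp (conjV E X) A - comp (comp A M) (comp (conjV E X) A) := by
  have hXA : Loc (comp X A) := hX.comp_spr hA
  have hCA : Loc (comp (conjV E X) A) := (loc_conjV hE hX).comp_spr hA
  have hAM : Tame (comp A M) := (spr_comp hA hM).tame
  have h2 := comp_eq_E_comp_comp_SX hA hE hR hX
  calc comp (comp A M) (comp X A) = comp (comp A M) (comp E (comp X A) - comp (conjV E X) A) := by rw [← h2]
    _ = comp (comp A M) (comp E (comp X A)) - comp (comp A M) (comp (conjV E X) A) :=
        comp_sub_right_tame hAM (hE.comp_loc hXA).tame hCA.tame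
    _ = comp (comp (comp A M) E) (comp X A) - comp (comp A M) (comp (conjV E X) A) := by rw [comp_assoc_tame hAM hE.tame hXA.tame]
    _ = comp E (comp X A) - comp (comp A M) (comp (conjV E X) A) := by rw [hR.AME]
    _ = comp X A + comp (conjV E X) A - comp (comp A M) (comp (conjV E X) A) := by rw [eq_add_of_sub_eq h2.symm]

/-- **TRACE RULE WITH COMMUTATOR** `tr(A∘(𝕄∘Y)) = tr(E∘Y) − tr(C_Y∘(A∘𝕄))` for localised `Y` (an2's `trace_KHY_rel` when `C_Y = 0`). -/
theorem trace_KHY_SX (hA : Spr A) (hM : Spr M) (hE : Spr E) (hR : RelInv A M E) {Y : MKer D F} (hY : Loc Y) :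
    tr (comp A (comp M Y)) = tr (comp E Y) - tr (comp (conjV E Y) (comp A M)) := by
  have sAM : Spr (comp A M) := spr_comp hA hM
  have hAM : Tame (comp A M) := sAM.tame
  have hYAM : Loc (comp Y (comp A M)) := hY.comp_spr sAM
  have hC : Loc (conjV E Y) := loc_conjV hE hY
  have hsplit : comp Y E = comp E Y - conjV E Y := by rw [conjV]; abel
  have h2 : comp Y (comp A M) = comp E (comp Y (comp A M)) - comp (conjV E Y) (comp A M) :=
    calc comp Y (comp A M) = comp Y (comp (comp E A) M) := by rw [hR.EA]
      _ = comp Y (comp E (comp A M)) := by rw [← comp_assoc_tame hE.tame hA.tame hM.tame]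
      _ = comp (comp Y E) (comp A M) := comp_assoc_tame hY.tame hE.tame hAM
      _ = comp (comp E Y - conjV E Y) (comp A M) := by rw [hsplit]
      _ = comp (comp E Y) (comp A M) - comp (conjV E Y) (comp A M) := comp_sub_left_tame (hE.comp_loc hY).tame hC.tame hAM
      _ = comp E (comp Y (comp A M)) - comp (conjV E Y) (comp A M) := by rw [comp_assoc_tame hE.tame hY.tame hAM]
  have h3 : tr (comp E (comp Y (comp A M))) = tr (comp E Y) :=
    calc tr (comp E (comp Y (comp A M))) = tr (comp (comp Y (comp A M)) E) := (tr_comp_comm_loc hYAM hE.tame).symm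
      _ = tr (comp Y (comp (comp A M) E)) := by rw [← comp_assoc_tame hY.tame hAM hE.tame]
      _ = tr (comp Y E) := by rw [hR.AME]
      _ = tr (comp E Y) := tr_comp_comm_loc hY hE.tame
  calc tr (comp A (comp M Y)) = tr (comp (comp A M) Y) := by rw [comp_assoc_tame hA.tame hM.tame hY.tame]
    _ = tr (comp Y (comp A M)) := (tr_comp_comm_loc hY hAM).symm
    _ = tr (comp E (comp Y (comp A M)) - comp (conjV E Y) (comp A M)) := by rw [← h2]
    _ = tr (comp E (comp Y (comp A M))) - tr (comp (conjV E Y) (comp A M)) := tr_sub_loc (hE.comp_loc hYAM) (hC.comp_spr sAM)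
    _ = tr (comp E Y) - tr (comp (conjV E Y) (comp A M)) := by rw [h3]

/-- **TRACE RULE WITH COMMUTATOR** `tr(A∘(Y∘𝕄)) = tr(E∘Y) + tr(C_Y∘(𝕄∘A))` for localised `Y` (an2's `trace_KYH_rel` when `C_Y = 0`). -/
theorem trace_KYH_SX (hA : Spr A) (hM : Spr M) (hE : Spr E) (hR : RelInv A M E) {Y : MKer D F} (hY : Loc Y) :
    tr (comp A (comp Y M)) = tr (comp E Y) + tr (comp (conjV E Y) (comp M A)) := by
  have sMA : Spr (comp M A) := spr_comp hM hA
  have hMA : Tame (comp M A) := sMA.tame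
  have hYM : Loc (comp Y M) := hY.comp_spr hM
  have hYMA : Loc (comp Y (comp M A)) := hY.comp_spr sMA
  have hC : Loc (conjV E Y) := loc_conjV hE hY
  have hsplit : comp E Y = comp Y E + conjV E Y := by rw [conjV]; abel
  have h2 : comp Y (comp M A) = comp (comp Y (comp M A)) E :=
    calc comp Y (comp M A) = comp Y (comp M (comp A E)) := by rw [hR.AE]
      _ = comp Y (comp (comp M A) E) := by rw [comp_assoc_tame hM.tame hA.tame hE.tame]
      _ = comp (comp Y (comp M A)) E := comp_assoc_tame hY.tame hMA hE.tame
  calc tr (comp A (comp Y M)) = tr (comp (comp Y M) A) := (tr_comp_comm_loc hYM hA.tame).symm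
    _ = tr (comp Y (comp M A)) := by rw [← comp_assoc_tame hY.tame hM.tame hA.tame]
    _ = tr (comp (comp Y (comp M A)) E) := by rw [← h2]
    _ = tr (comp E (comp Y (comp M A))) := tr_comp_comm_loc hYMA hE.tame
    _ = tr (comp (comp E Y) (comp M A)) := by rw [comp_assoc_tame hE.tame hY.tame hMA]
    _ = tr (comp (comp Y E + conjV E Y) (comp M A)) := by rw [hsplit]
    _ = tr (comp (comp Y E) (comp M A) + comp (conjV E Y) (comp M A)) := by rw [comp_add_left_tame (hY.comp_spr hE).tame hC.tame hMA]
    _ = tr (comp (comp Y E) (comp M A)) + tr (comp (conjV E Y) (comp M A)) :=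
        tr_add_loc ((hY.comp_spr hE).comp_spr sMA) (hC.comp_spr sMA)
    _ = tr (comp Y (comp E (comp M A))) + tr (comp (conjV E Y) (comp M A)) := by rw [← comp_assoc_tame hY.tame hE.tame hMA]
    _ = tr (comp Y (comp (comp E M) A)) + tr (comp (conjV E Y) (comp M A)) := by rw [comp_assoc_tame hE.tame hM.tame hA.tame]
    _ = tr (comp Y E) + tr (comp (conjV E Y) (comp M A)) := by rw [hR.EMA]
    _ = tr (comp E Y) + tr (comp (conjV E Y) (comp M A)) := by rw [tr_comp_comm_loc hY hE.tame]

end Rules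

/-! ## §2 The defects of K4a are commutator-valued over a relative inverse -/

/-- LEIBNIZ for the slice commutator: `C_{X′∘X} = C_{X′}∘X + X′∘C_X` (spread `E`, localised `X′`, `X`; no inverse relation). -/
theorem conjV_comp_leibniz {E Xp X : MKer D F} (hE : Spr E) (hXp : Loc Xp) (hX : Loc X) :
    conjV E (comp Xp X) = comp (conjV E Xp) X + comp Xp (conjV E X) := by
  unfold conjV
  rw [comp_sub_left_tame (hE.comp_loc hXp).tame (hXp.comp_spr hE).tame hX.tame,
    comp_sub_right_tame hXp.tame (hE.comp_loc hX).tame (hX.comp_spr hE).tame, comp_assoc_tame hE.tame hXp.tame hX.tame,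
    comp_assoc_tame hXp.tame hE.tame hX.tame, comp_assoc_tame hXp.tame hX.tame hE.tame]
  abel

section Defects

variable {A M E : MKer D F}

/-- **THE SANDWICH DEFECT IS COMMUTATOR-VALUED**: over `RelInv A 𝕄 E`,
`S_X = (A∘conjV 𝕄 X)∘A + conjV A X = C_X∘A + A∘C_X − (A∘𝕄)∘(C_X∘A) − (A∘C_X)∘(𝕄∘A)`, `C_X = conjV E X`
(the owner's (K); `= 0` when `C_X = 0`, cf. `RelInvSandwich.sandwich_conjV_rel`). -/
theorem sandwichDefect_rel (hA : Spr A) (hM : Spr M) (hE : Spr E) (hR : RelInv A M E) {X : MKer D F} (hX : Loc X) :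
    comp (comp A (conjV M X)) A + conjV A X
      = comp (conjV E X) A + comp A (conjV E X) - comp (comp A M) (comp (conjV E X) A)
        - comp (comp A (conjV E X)) (comp M A) := by
  have hMX : Loc (comp M X) := hM.comp_loc hX
  have hXM : Loc (comp X M) := hX.comp_spr hM
  have hAX : Loc (comp A X) := hA.comp_loc hX
  have hAM : Tame (comp A M) := (spr_comp hA hM).tame
  rw [show conjV M X = comp M X - comp X M from rfl, comp_sub_right_tame hA.tame hMX.tame hXM.tame,
    comp_sub_left_tame (hA.comp_loc hMX).tame (hA.comp_loc hXM).tame hA.tame, comp_assoc_tame hA.tame hM.tame hX.tame,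
    ← comp_assoc_tame hAM hX.tame hA.tame, comp_assoc_tame hA.tame hX.tame hM.tame, ← comp_assoc_tame hAX.tame hM.tame hA.tame,
    rule_left_SX hA hM hE hR hX, rule_right_SX hA hM hE hR hX, show conjV A X = comp A X - comp X A from rfl]
  abel

/-- **THE TRACE DEFECT IS COMMUTATOR-VALUED**: over `RelInv A 𝕄 E`, for localised `Y`,
`τ(Y) = tr(Y∘conjV 𝕄 A) = tr(C_Y∘(𝕄∘A)) + tr(C_Y∘(A∘𝕄))`, `C_Y = conjV E Y` (`= 0` when `C_Y = 0`, cf.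
`SecondOrderSymContact.tadpole_conjV_rel_eq_zero`). -/
theorem traceDefect_rel (hA : Spr A) (hM : Spr M) (hE : Spr E) (hR : RelInv A M E) {Y : MKer D F} (hY : Loc Y) :
    tr (comp Y (conjV M A)) = tr (comp (conjV E Y) (comp M A)) + tr (comp (conjV E Y) (comp A M)) := by
  have sAM : Spr (comp A M) := spr_comp hA hM
  have sMA : Spr (comp M A) := spr_comp hM hA
  have e1 : tr (comp Y (comp M A)) = tr (comp A (comp Y M)) := by
    rw [comp_assoc_tame hY.tame hM.tame hA.tame, tr_comp_comm_loc (hY.comp_spr hM) hA.tame]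
  have e2 : tr (comp Y (comp A M)) = tr (comp A (comp M Y)) := by
    rw [tr_comp_comm_loc hY sAM.tame, ← comp_assoc_tame hA.tame hM.tame hY.tame]
  rw [show conjV M A = comp M A - comp A M from rfl, comp_sub_right_tame hY.tame sMA.tame sAM.tame,
    tr_sub_loc (hY.comp_spr sMA) (hY.comp_spr sAM), e1, e2, trace_KYH_SX hA hM hE hR hY, trace_KHY_SX hA hM hE hR hY]
  ring

/-- **`hess_conj_defect_rel`** — K4a's `hess_conj_defect` over `RelInv A 𝕄 E` with the trace-defect pair in COMMUTATOR currency: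
`½·tadpole A (W + conjW …) − ½·bubble A (V + conjV 𝕄 X) (V′ + conjV 𝕄 X′) = ½·tadpole A W − ½·bubble A V V′ + Δ`,
`Δ = ½·((tr(C_{X′X}∘(𝕄∘A)) + tr(C_{X′X}∘(A∘𝕄))) − (tr(C_{X₂}∘(𝕄∘A)) + tr(C_{X₂}∘(A∘𝕄)))) − ½·(tr(S_X∘V′) + tr(S_{X′}∘V) + tr(S_X∘conjV 𝕄 X′))`
(`S_X` displayed inline; its commutator value is `sandwichDefect_rel`). -/
theorem hess_conj_defect_rel (hA : Spr A) (hM : Spr M) (hE : Spr E) (hR : RelInv A M E) {V Vp W X Xp X₂ : MKer D F}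
    (hV : Loc V) (hVp : Loc Vp) (hW : Loc W) (hX : Loc X) (hXp : Loc Xp) (hX₂ : Loc X₂) :
    (1 / 2 : ℝ) * tadpole A (W + conjW M V Vp X Xp X₂) - (1 / 2 : ℝ) * bubble A (V + conjV M X) (Vp + conjV M Xp)
      = (1 / 2 : ℝ) * tadpole A W - (1 / 2 : ℝ) * bubble A V Vp
        + ((1 / 2 : ℝ) * ((tr (comp (conjV E (comp Xp X)) (comp M A)) + tr (comp (conjV E (comp Xp X)) (comp A M)))
              - (tr (comp (conjV E X₂) (comp M A)) + tr (comp (conjV E X₂) (comp A M))))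
          - (1 / 2 : ℝ) * (tr (comp (comp (comp A (conjV M X)) A + conjV A X) Vp)
              + tr (comp (comp (comp A (conjV M Xp)) A + conjV A Xp) V)
              + tr (comp (comp (comp A (conjV M X)) A + conjV A X) (conjV M Xp)))) := by
  rw [hess_conj_defect hA hM hV hVp hW hX hXp hX₂, traceDefect_rel hA hM hE hR (hXp.comp hX), traceDefect_rel hA hM hE hR hX₂]

end Defects

/-! ## §3 Commuting generators: `Δ = 0` over a relative inverse, and an2's `hess_conj_invariant_rel` recovered -/

section Comm

variable {A M E : MKer D F}

/-- Over `RelInv A 𝕄 E`, if the generators `X, X′, X₂` commute with `E` then K4a's defect `Δ` VANISHES (every commutator `C` is `0`). -/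
theorem delta_rel_of_comm (hA : Spr A) (hM : Spr M) (hE : Spr E) (hR : RelInv A M E) {V Vp X Xp X₂ : MKer D F} (hX : Loc X)
    (hXp : Loc Xp) (hX₂ : Loc X₂) (hEX : comp E X = comp X E) (hEXp : comp E Xp = comp Xp E) (hEX₂ : comp E X₂ = comp X₂ E) :
    (1 / 2 : ℝ) * (tr (comp (comp Xp X) (conjV M A)) - tr (comp X₂ (conjV M A)))
        - (1 / 2 : ℝ) * (tr (comp (comp (comp A (conjV M X)) A + conjV A X) Vp)
            + tr (comp (comp (comp A (conjV M Xp)) A + conjV A Xp) V)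
            + tr (comp (comp (comp A (conjV M X)) A + conjV A X) (conjV M Xp))) = 0 := by
  have hc0 : ∀ Z : MKer D F, comp (0 : MKer D F) Z = 0 := fun Z => by
    funext x z a b
    simp only [ExpKernelCalculus.comp, Pi.zero_apply, zero_mul, Finset.sum_const_zero, tsum_zero]
  have ht0 : tr (0 : MKer D F) = 0 := by
    simp only [ExpKernelCalculus.tr, Pi.zero_apply, Finset.sum_const_zero, tsum_zero]
  have hCX : conjV E X = 0 := by rw [conjV, hEX, sub_self]
  have hCXp : conjV E Xp = 0 := by rw [conjV, hEXp, sub_self]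
  have hCX₂ : conjV E X₂ = 0 := by rw [conjV, hEX₂, sub_self]
  have hCXpX : conjV E (comp Xp X) = 0 := by
    rw [conjV_comp_leibniz hE hXp hX, hCX, hCXp, hc0, StepDriftWitness.comp_zero_right, add_zero]
  have hSX : comp (comp A (conjV M X)) A + conjV A X = 0 := by
    rw [sandwichDefect_rel hA hM hE hR hX, hCX, hc0, StepDriftWitness.comp_zero_right, StepDriftWitness.comp_zero_right, hc0,
      sub_zero, sub_zero, add_zero]
  have hSXp : comp (comp A (conjV M Xp)) A + conjV A Xp = 0 := by
    rw [sandwichDefect_rel hA hM hE hR hXp, hCXp, hc0, StepDriftWitness.comp_zero_right, StepDriftWitness.comp_zero_right, hc0,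
      sub_zero, sub_zero, add_zero]
  rw [traceDefect_rel hA hM hE hR (hXp.comp hX), traceDefect_rel hA hM hE hR hX₂, hCXpX, hCX₂, hSX, hSXp, hc0, hc0, hc0, hc0, hc0,
    ht0]
  ring

/-- JUNCTION (an2's `ChartConjugationRelative.hess_conj_invariant_rel` RECOVERED from K4a's `hess_conj_defect` + `delta_rel_of_comm`;
an `example`, so that no statement of the tree is re-declared). -/
example (hA : Spr A) (hM : Spr M) (hE : Spr E) (hR : RelInv A M E) {V Vp W X Xp X₂ : MKer D F}
    (hV : Loc V) (hVp : Loc Vp) (hW : Loc W) (hX : Loc X) (hXp : Loc Xp) (hX₂ : Loc X₂) (hEX : comp E X = comp X E)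
    (hEXp : comp E Xp = comp Xp E) (hEX₂ : comp E X₂ = comp X₂ E) :
    (1 / 2 : ℝ) * tadpole A (W + conjW M V Vp X Xp X₂) - (1 / 2 : ℝ) * bubble A (V + conjV M X) (Vp + conjV M Xp)
      = (1 / 2 : ℝ) * tadpole A W - (1 / 2 : ℝ) * bubble A V Vp := by
  rw [hess_conj_defect hA hM hV hVp hW hX hXp hX₂,
    delta_rel_of_comm (V := V) (Vp := Vp) hA hM hE hR hX hXp hX₂ hEX hEXp hEX₂, add_zero]

end Comm

end

end Summit.QuantumFields.BalabanUV.Beta.ChartConjugationRelativeSX
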